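import Summits.AnomalousDissipation.AnomalousDissipation.Theses.DopplerClock
import Literature.Analysis.FluidPDE.LinearizedNSTorus
import Literature.Analysis.FluidPDE.TorusClassicalLerayHopfProofs
import Literature.Analysis.FluidPDE.LerayHopfTimeSliceTorus
import Summits.AnomalousDissipation.AnomalousDissipation.Theorems.DopplerClockDopplerWorkIdentity
import Summits.AnomalousDissipation.AnomalousDissipation.Theorems.DopplerClockForceAdmissible
import Summits.AnomalousDissipation.AnomalousDissipation.Theorems.DopplerClockQuadratureStressFloorEnergyFreeBridge

/-!
# Line `oseen-memory-doppler-line` for the crux `DopplerClock.QuadratureStressFloor` (stmt-AnomalousDissipation-18129)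
# — crux-plan, 2026-08-17 (card: Cruxes/QuadratureStressFloor/Ideas/oseen-memory-doppler-line.md; line card Lines/oseen-memory-doppler-line.md)

THE LINE. Along a STEADY witness `U` of `NS_ν(f)`, Navier–Stokes is the forced LINEAR Oseen evolution
`∂ₜu = A_U u + f`, `A_U = νΔ − ℙ(U·∇·)` (an `L²`-contraction generator), so the injection `W = (f,U) = ν‖∇U‖²` is
EXACTLY the Green–Kubo mass `∫₀^∞ C(τ) dτ` of the forced-plane memory kernel `C(τ) = (f, v(τ))`, `v` = the Oseen
RELEASE of the force (`∂_τ v + (U·∇)v = νΔv − ∇q`, `div v = 0`, `v(0) = f`). The kernel starts at `C(0) = ‖f‖²` and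
cannot leave it faster than the witness's ENERGY allows (kinematic head, provable), so a ν-uniform injection floor —
hence, for steady drift states, the quadrature stress floor (census: `crux_of_loudSteady`, PROVED) — follows from ONE
shape property of ONE linear contraction propagator: the running Green–Kubo integral never gives back more than a
fixed fraction `θ < 1` of what it has accumulated (NO ECHO of forced-plane memory). Laminar / swept / x₀-invariant
carriers have the COHERENT kernel `‖f‖² e^{−νκ²τ} cos ωτ`, whose running integral returns to `≈ 0` after one clock
period: they violate no-echo for every `θ < 1` — the quiet competitors are exactly the echoing kernels.

REGISTERED STUBS (sorries ONLY here):
* `stub_threeDimSteadyStates` — EXISTENCE (conjecture-class; global continuation of the pitchfork branch of the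
  registered line `steady-pitchfork-branch`, same pinned design (m,n) = (1,2), G = 4, `V = 1/8`, `F = π/2`): along some
  `ν_j → 0⁺` there are `R₂`-symmetric steady drift states with x₀-DEPENDENT ("wave") energy `≥ ½V₀²` (super-Doppler
  three-dimensionality: r.m.s. 3-D speed ≥ drift speed) and kinetic energy `≤ E₀`; NO loudness asserted.
* `stub_oseenRelease` — the Oseen release of a smooth divergence-free mean-zero datum along a smooth divergence-free
  carrier exists globally and smoothly (linear parabolic theory; provable-class).
* `stub_greenKubo` — STEADY GREEN–KUBO IDENTITY `∫₀ᵀ (f, v(τ)) dτ → (f, U)` (provable-class: `χ(T) = ∫₀ᵀ v` solves the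
  steady Oseen problem with right side `f − v(T)`, `‖v(T)‖ ≤ e^{−4π²νT}‖f‖`, Poincaré).
* `stub_kinematicHead` — KINEMATIC HEAD (provable-class): `∫₀^{τ_h} C ≥ h > 0` with `τ_h, h` depending only on the
  design and the energy bound (`C(0) = ‖f‖²`, `|C'| ≤ ‖f‖(‖∇f‖_∞ (2E₀)^{1/2} + νκ²‖f‖)`, `L²`-contraction).
* `stub_noEcho` — THE CORE (conjecture-class; rigidity of the forced-plane memory of super-Doppler three-dimensional
  bounded-energy symmetric steady drift states): running-max retention `(1 − θ) I(a) ≤ I(T)` for `0 ≤ a ≤ T`.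
* `QuadratureStressFloor_of : stub₁ → … → stub₅ → QuadratureStressFloor` — REAL PROOF (tail in `j`, head + retention +
  Green–Kubo ⇒ `(f,U_j) ≥ (1−θ)h`, steady energy identity, energy bound ⇒ size clause, `crux_of_loudSteady`).
-/

set_option linter.dupNamespace false
set_option linter.unusedVariables false

noncomputable section

namespace Summit.AnomalousDissipation.AnomalousDissipation.Cruxes.QuadratureStressFloor.OseenMemoryDopplerLine

open scoped Topology InnerProductSpace
open Filter Set MeasureTheory
open Summit.AnomalousDissipation.AnomalousDissipation.Theses.DopplerClock
open Literature.Analysis.FluidPDE Literature.Analysis.FluidPDE.Torus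
open Literature.Analysis.FunctionSpaces Literature.Analysis.FunctionSpaces.Torus

local notation "𝕋³" => UnitAddTorus (Fin 3)
local notation "E³" => EuclideanSpace ℝ (Fin 3)

/-! ## §0 Vocabulary (verbatim from the strategist's census / line `steady-pitchfork-branch`; `Cruxes/` modules are
workfiles, not library modules, so the shared vocabulary is re-declared here) -/

/-- The route's force `f = F sin(2πm x₁) cos(2πn x₂) e₀` (character-for-character the crux's). [folklore] -/
def force (F : ℝ) (m n : ℕ) : 𝕋³ → E³ := fun x =>
  (F * (UnitAddTorus.mFourier (Pi.single (1 : Fin 3) (m : ℤ)) x).im *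
      (UnitAddTorus.mFourier (Pi.single (2 : Fin 3) (n : ℤ)) x).re) •
    EuclideanSpace.single (0 : Fin 3) (1 : ℝ)

/-- The quadrature streak pattern `Ψ_s = sin(2πm x₁) sin(2πn x₂) e₀`. [folklore] -/
def psiS (m n : ℕ) : 𝕋³ → E³ := fun y =>
  ((UnitAddTorus.mFourier (Pi.single (1 : Fin 3) (m : ℤ)) y).im *
      (UnitAddTorus.mFourier (Pi.single (2 : Fin 3) (n : ℤ)) y).im) •
    EuclideanSpace.single (0 : Fin 3) (1 : ℝ)

/-- The drift (conserved momentum) `V e₂`. [folklore] -/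
def drift (V : ℝ) : E³ := V • EuclideanSpace.single (2 : Fin 3) (1 : ℝ)

/-- The injection `(f, v)`. [folklore] -/
def injection (F : ℝ) (m n : ℕ) (v : 𝕋³ → E³) : ℝ := ∫ x, ⟪force F m n x, v x⟫_ℝ

/-- The quadrature stress `T_s(w) = ∫ ⟪w, (w·∇)Ψ_s⟫`, `w = v − V e₂`. [folklore] -/
def stressS (V : ℝ) (m n : ℕ) (v : 𝕋³ → E³) : ℝ :=
  ∫ x, ⟪v x - drift V, convect (fun y => v y - drift V) (psiS m n) x⟫_ℝ

/-- The crux BY NAME in this vocabulary (definitional). [folklore] -/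
theorem crux_iff :
    QuadratureStressFloor ↔
      ∃ (F V : ℝ) (m n : ℕ), 0 < F ∧ 0 < V ∧ 0 < m ∧ 0 < n ∧ ∃ Λ : GeneralizedLimit,
        ∃ (ν : ℕ → ℝ) (u₀ : ℕ → 𝕋³ → E³) (u : ℕ → ℝ → 𝕋³ → E³),
          (∀ j, 0 < ν j) ∧ Tendsto ν atTop (𝓝 0) ∧
          (∀ j, IsGlobalLerayHopf (ν j) (fun _ => force F m n) (u₀ j) (u j)) ∧
          (∀ j, ∫ x, u₀ j x = drift V) ∧
          (∀ j, ∃ C : ℝ, ∀ t : ℝ, 0 ≤ t → kineticEnergy (u j t) ≤ C) ∧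
          (∀ j, longTimeAvgSup (fun t => injection F m n (u j t)) ≤ meanDissipation (ν j) (u j)) ∧
          ∃ ε₀ : ℝ, 0 < ε₀ ∧ ∀ j, ε₀ ≤ -Λ.longTimeAvg (fun t => stressS V m n (u j t)) :=
  Iff.rfl

/-! ### Junk-free calculus of constant-in-time observables -/

/-- Cesàro mean of a constant over `[0,T]`, `T ≠ 0`. [folklore] -/
theorem timeMean_const {c T : ℝ} (hT : T ≠ 0) : timeMean (fun _ => c) T = c := by
  unfold timeMean
  rw [intervalIntegral.integral_const, sub_zero, smul_eq_mul, ← mul_assoc, inv_mul_cancel₀ hT, one_mul]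

/-- The Cesàro means of a constant tend to it. [folklore] -/
theorem tendsto_timeMean_const (c : ℝ) : Tendsto (timeMean fun _ => c) atTop (𝓝 c) := by
  refine tendsto_const_nhds.congr' ?_
  filter_upwards [eventually_gt_atTop 0] with T hT
  exact (timeMean_const (c := c) hT.ne').symm

/-- `⟨c⟩⁺ = c`. [folklore] -/
theorem longTimeAvgSup_const (c : ℝ) : longTimeAvgSup (fun _ => c) = c :=
  (tendsto_timeMean_const c).limsup_eq

/-- `⟨c⟩_Λ = c` for every generalized limit. [folklore] -/
theorem longTimeAvg_const (Λ : GeneralizedLimit) (c : ℝ) : Λ.longTimeAvg (fun _ => c) = c :=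
  Λ.longTimeAvg_eq_of_tendsto (tendsto_timeMean_const c)

/-- The steady energy identity `ν‖∇u‖² = (f, u)` for a classical steady state. [folklore] -/
theorem steady_energy_identity {ν : ℝ} {f u : 𝕋³ → E³} {p : 𝕋³ → ℝ}
    (h : IsClassicalNSSolutionOn Set.univ ν (fun _ => f) (fun _ => u) (fun _ => p)) :
    ν * gradNormSq u = ∫ x, ⟪f x, u x⟫_ℝ := by
  have hE := h.energy_eq convex_univ (zero_le_one (α := ℝ)) (Set.subset_univ _)
  simp only [intervalIntegral.integral_const, sub_zero, one_smul] at hE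
  linarith

/-! ### Steady witnesses prove the crux (census §S1, PROVED) -/

/-- **S⁺_steady.** Some design, `ν_j → 0⁺`, smooth STEADY states of `NS_{ν_j}(f)` with momentum `V e₂` and a
quadrature stress floor. [folklore] -/
def SteadyStressFloorStates : Prop :=
  ∃ (F V : ℝ) (m n : ℕ), 0 < F ∧ 0 < V ∧ 0 < m ∧ 0 < n ∧
    ∃ (ν : ℕ → ℝ) (u : ℕ → 𝕋³ → E³) (p : ℕ → 𝕋³ → ℝ),
      (∀ j, 0 < ν j) ∧ Tendsto ν atTop (𝓝 0) ∧
      (∀ j, IsSteadyNSState (ν j) (force F m n) (u j) (p j)) ∧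
      (∀ j, ∫ x, u j x = drift V) ∧
      ∃ ε₀ : ℝ, 0 < ε₀ ∧ ∀ j, ε₀ ≤ -stressS V m n (u j)

/-- **Steady loud drift states prove the crux** (PROVED): a classical steady state is a global Leray–Hopf
solution from itself, no-leak holds WITH EQUALITY, and every mean of a constant observable is that constant. [folklore] -/
theorem crux_of_steady (h : SteadyStressFloorStates) : QuadratureStressFloor := by
  obtain ⟨F, V, m, n, hF, hV, hm, hn, ν, u, p, hν, hν0, hst, hmom, ε₀, hε₀, hfloor⟩ := h
  obtain ⟨Λ⟩ := GeneralizedLimit.nonempty_holds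
  rw [crux_iff]
  refine ⟨F, V, m, n, hF, hV, hm, hn, Λ, ν, u, fun j _ => u j, hν, hν0, fun j => (hst j).isGlobalLerayHopf,
    hmom, fun j => ⟨kineticEnergy (u j), fun t _ => le_rfl⟩, fun j => ?_, ε₀, hε₀, fun j => ?_⟩
  · have hsm : IsSmooth (u j) := (hst j).smooth_velocity.isSmooth_slice (Set.mem_univ (0 : ℝ))
    have hid : ν j * gradNormSq (u j) = injection F m n (u j) := steady_energy_identity (hst j)
    show longTimeAvgSup (fun _ : ℝ => injection F m n (u j)) ≤
      longTimeAvgSup (fun _ : ℝ => ν j * (eGradNormSq (u j)).toReal)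
    rw [longTimeAvgSup_const, longTimeAvgSup_const, ← gradNormSq_eq_toReal_eGradNormSq_holds hsm, hid]
  · show ε₀ ≤ -Λ.longTimeAvg (fun _ : ℝ => stressS V m n (u j))
    rw [longTimeAvg_const]
    exact hfloor j

/-- The quadrature streak coefficient `B(v) = (Ψ_s, v)`. [folklore] -/
def quadB (m n : ℕ) (v : 𝕋³ → E³) : ℝ := ∫ x, ⟪psiS m n x, v x⟫_ℝ

/-- **Steady Doppler work identity** (from the landed item 18133): `(f,U) = F/(V·2πn)·(νκ²(Ψ_s,U) − T_s(U − Ve₂))`. [folklore] -/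
theorem steady_work_identity {F V ν : ℝ} {m n : ℕ} {U : 𝕋³ → E³} {p : 𝕋³ → ℝ}
    (hV : 0 < V) (hν : 0 < ν) (hn : 0 < n) (hst : IsSteadyNSState ν (force F m n) U p)
    (hmom : ∫ x, U x = drift V) :
    injection F m n U =
      F / (V * (2 * Real.pi * n)) *
        (ν * ((2 * Real.pi) ^ 2 * ((m : ℝ) ^ 2 + (n : ℝ) ^ 2)) * quadB m n U - stressS V m n U) := by
  obtain ⟨Λ⟩ := GeneralizedLimit.nonempty_holds
  have h := Summit.AnomalousDissipation.AnomalousDissipation.Theorems.dopplerWorkIdentity_proof Λ F V ν m n U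
    (fun _ => U) hV hν hn hst.isGlobalLerayHopf hmom ⟨kineticEnergy U, fun t _ => le_rfl⟩
  simp only [longTimeAvg_const] at h
  exact h

/-- **On steady drift states a DISSIPATION floor is a quadrature STRESS floor** (PROVED). [folklore] -/
theorem steady_stressFloor_of_dissipationFloor {F V ν ε δ : ℝ} {m n : ℕ} {U : 𝕋³ → E³} {p : 𝕋³ → ℝ}
    (hF : 0 < F) (hV : 0 < V) (hν : 0 < ν) (hn : 0 < n) (hst : IsSteadyNSState ν (force F m n) U p)
    (hmom : ∫ x, U x = drift V) (hε : ε ≤ ν * gradNormSq U)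
    (hδ : ν * ((2 * Real.pi) ^ 2 * ((m : ℝ) ^ 2 + (n : ℝ) ^ 2)) * |quadB m n U| ≤ δ) :
    V * (2 * Real.pi * n) / F * ε - δ ≤ -stressS V m n U := by
  have hid : ν * gradNormSq U = injection F m n U := steady_energy_identity hst
  have hw := steady_work_identity hV hν hn hst hmom
  set κ2 : ℝ := (2 * Real.pi) ^ 2 * ((m : ℝ) ^ 2 + (n : ℝ) ^ 2) with hκ2
  set ω : ℝ := V * (2 * Real.pi * n) with hω
  have hn' : (0 : ℝ) < n := by exact_mod_cast hn
  have hωpos : 0 < ω := by rw [hω]; positivity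
  have hκ2 : 0 ≤ κ2 := by rw [hκ2]; positivity
  have hT : -stressS V m n U = ω / F * injection F m n U - ν * κ2 * quadB m n U := by
    rw [hw]
    field_simp
    ring
  have hB : -(ν * κ2 * quadB m n U) ≥ -δ := by
    have h1 : ν * κ2 * quadB m n U ≤ ν * κ2 * |quadB m n U| :=
      mul_le_mul_of_nonneg_left (le_abs_self _) (mul_nonneg hν.le hκ2)
    linarith
  have hI : ω / F * ε ≤ ω / F * injection F m n U :=
    mul_le_mul_of_nonneg_left (hid ▸ hε) (div_nonneg hωpos.le hF.le)
  rw [hT]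
  have : V * (2 * Real.pi * ↑n) / F * ε = ω / F * ε := by rw [hω]
  linarith

/-- **Loud steady drift states** (dissipation form). [folklore] -/
def SteadyLoudDriftStates : Prop :=
  ∃ (F V : ℝ) (m n : ℕ), 0 < F ∧ 0 < V ∧ 0 < m ∧ 0 < n ∧
    ∃ (ν : ℕ → ℝ) (u : ℕ → 𝕋³ → E³) (p : ℕ → 𝕋³ → ℝ),
      (∀ j, 0 < ν j) ∧ Tendsto ν atTop (𝓝 0) ∧
      (∀ j, IsSteadyNSState (ν j) (force F m n) (u j) (p j)) ∧
      (∀ j, ∫ x, u j x = drift V) ∧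
      ∃ ε δ : ℝ, 0 < ε ∧ δ < V * (2 * Real.pi * n) / F * ε ∧
        (∀ j, ε ≤ ν j * gradNormSq (u j)) ∧
        ∀ j, ν j * ((2 * Real.pi) ^ 2 * ((m : ℝ) ^ 2 + (n : ℝ) ^ 2)) * |quadB m n (u j)| ≤ δ

/-- Loud steady drift states have a quadrature stress floor (PROVED). [folklore] -/
theorem steadyStressFloor_of_loud (h : SteadyLoudDriftStates) : SteadyStressFloorStates := by
  obtain ⟨F, V, m, n, hF, hV, hm, hn, ν, u, p, hν, hν0, hst, hmom, ε, δ, hε, hδε, hfl, hB⟩ := h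
  refine ⟨F, V, m, n, hF, hV, hm, hn, ν, u, p, hν, hν0, hst, hmom, V * (2 * Real.pi * n) / F * ε - δ,
    by linarith, fun j => ?_⟩
  exact steady_stressFloor_of_dissipationFloor hF hV (hν j) hn (hst j) (hmom j) (hfl j) (hB j)

/-- COMPOSITION (PROVED): loud steady drift states ⟹ the crux by name. [folklore] -/
theorem crux_of_loudSteady (h : SteadyLoudDriftStates) : QuadratureStressFloor :=
  crux_of_steady (steadyStressFloor_of_loud h)

/-! ### Symmetry and the pinned design (shared with line `steady-pitchfork-branch`) -/

/-- The reflection `R₂ : x ↦ Sx`, `S = diag(−1,−1,1)`, on the torus. [folklore] -/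
def reflS (x : 𝕋³) : 𝕋³ := fun i => if i = 2 then x i else -x i

/-- `S = diag(−1,−1,1)` on velocity values. [folklore] -/
def vecS (v : E³) : E³ := !₂[-(v 0), -(v 1), v 2]

/-- `u` is `R₂`-symmetric: `u(Sx) = S u(x)`. [folklore] -/
def IsR2Symmetric (u : 𝕋³ → E³) : Prop := ∀ x, u (reflS x) = vecS (u x)

/-- Pinned design: amplitude `F = π/2` ((m,n) = (1,2), clock number G = 4, streak units). [folklore] -/
def F₀ : ℝ := Real.pi / 2

/-- Pinned design: drift `V = 1/8`. [folklore] -/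
def V₀ : ℝ := 1 / 8

/-- The pinned design has `2πnV/F = 1`. [folklore] -/
theorem design_ratio : V₀ * (2 * Real.pi * (2 : ℕ)) / F₀ = 1 := by
  unfold V₀ F₀
  have hπ : Real.pi ≠ 0 := Real.pi_ne_zero
  field_simp
  push_cast
  ring

/-! ## §1 New vocabulary of this line: three-dimensionality, the Oseen release, the memory kernel -/

/-- The longitudinal (`x₀`-) average `Ū(x) = ∫_{𝕋} U(x + s e₀) ds` of a field. [folklore] -/
def xAvg (U : 𝕋³ → E³) : 𝕋³ → E³ := fun x => ∫ c : UnitAddCircle, U (x + Pi.single (0 : Fin 3) c)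

/-- The x₀-DEPENDENT (genuinely three-dimensional, "wave") energy `½∫‖U − Ū‖²` — the part of the witness the
forced-plane memory kernel sees (x₀-invariant carriers do not scatter the forced plane: LongitudinalClassQuiet,
item 18134; the Feshbach self-energy `Σ_U` is quadratic in `U − Ū`). [folklore] -/
def waveEnergy (U : 𝕋³ → E³) : ℝ := kineticEnergy (fun x => U x - xAvg U x)

/-- **The Oseen release `v` of a datum `g` along a (steady) carrier `U` at viscosity `ν`**: a classical solution on
`[0,∞) × 𝕋³` of the LINEAR advection–diffusion–projection system `∂_τ v + (U·∇)v = νΔv − ∇q`, `div v = 0`,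
`∫ v = 0`, `v(0) = g` (the evolution `e^{τ A_U}`, `A_U = νΔ − ℙ(U·∇·)`: advection by the witness, NO reaction term
`(v·∇)U`, hence an `L²`-contraction). Fields as in `Torus.IsClassicalNSSolutionOn` (one-sided time derivative
`timeDerivWithin (Ici 0)`). [folklore] -/
def IsOseenRelease (ν : ℝ) (U g : 𝕋³ → E³) (v : ℝ → 𝕋³ → E³) : Prop :=
  ∃ q : ℝ → 𝕋³ → ℝ,
    IsSmoothSpaceTimeOn (Set.Ici 0) v ∧ IsSmoothSpaceTimeOn (Set.Ici 0) q ∧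
    (∀ τ ∈ Set.Ici (0 : ℝ), ∀ x,
      Torus.timeDerivWithin (Set.Ici 0) v τ x + convect U (v τ) x =
        ν • Torus.laplacian (v τ) x - Torus.gradient (q τ) x) ∧
    (∀ τ ∈ Set.Ici (0 : ℝ), IsDivFree (v τ)) ∧ (∀ τ ∈ Set.Ici (0 : ℝ), HasZeroMean (v τ)) ∧ v 0 = g

/-- The forced-plane MEMORY KERNEL `C(τ) = (f, v(τ))` of a release `v` (for the Oseen release of `f` along a steady
witness `U`: `C(τ) = (f, e^{τA_U} f)`; laminar carrier: `‖f‖² e^{−νκ²τ} cos ωτ`). [folklore] -/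
def memKernel (F : ℝ) (m n : ℕ) (v : ℝ → 𝕋³ → E³) (τ : ℝ) : ℝ := injection F m n (v τ)

/-- The running GREEN–KUBO integral `I(T) = ∫₀ᵀ C(τ) dτ`. [folklore] -/
def gkIntegral (F : ℝ) (m n : ℕ) (v : ℝ → 𝕋³ → E³) (T : ℝ) : ℝ := ∫ τ in (0 : ℝ)..T, memKernel F m n v τ

/-! ## §2 The five registered stubs -/

/-- Signature of `stub_threeDimSteadyStates` (EXISTENCE; conjecture-class — global continuation to `ν → 0` of the
`R₂`-symmetric pitchfork branch of the pinned design (kit j023236: real simple-in-`Fix(R₂)` crossing at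
`ν_c ≈ 10⁻²`), with the two properties loud witnesses must have: SUPER-DOPPLER THREE-DIMENSIONALITY — the
x₀-dependent ("wave") energy is at least the drift energy `½V₀²`, i.e. r.m.s. three-dimensional velocity ≥ the
drift speed that runs the Doppler clock (census B5 / item 18134: x₀-invariant classes are quiet; near-laminar
states of every later crossing are excluded by this cut, triage T1 (1)) — and kinetic energy bounded above (the
steady shadow of the route's C2 `InjectionControlsEnergy`). NO loudness is asserted (lead c2's test: this stub does
not give the energy-free injection-floor family of p168484). Only a SEQUENCE `ν_j → 0⁺` is asserted. -/
def Sig.stub_threeDimSteadyStates : Prop :=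
  ∃ E₀ : ℝ, 0 < E₀ ∧
    ∃ (ν : ℕ → ℝ) (u : ℕ → 𝕋³ → E³) (p : ℕ → 𝕋³ → ℝ),
      (∀ j, 0 < ν j) ∧ Tendsto ν atTop (𝓝 0) ∧
      ∀ j, IsSteadyNSState (ν j) (force F₀ 1 2) (u j) (p j) ∧ (∫ x, u j x = drift V₀) ∧
        IsR2Symmetric (u j) ∧ V₀ ^ 2 / 2 ≤ waveEnergy (u j) ∧ kineticEnergy (u j) ≤ E₀

/-- Signature of `stub_oseenRelease` (provable-class, L: global smooth solvability of the linear Oseen /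
advection–diffusion–Leray-projection system on `𝕋³` with a smooth divergence-free steady carrier and a smooth
divergence-free mean-zero datum — Galerkin + energy estimates at every Sobolev order, or the analytic semigroup of
the Stokes operator perturbed by the bounded-below first-order term). -/
def Sig.stub_oseenRelease : Prop :=
  ∀ (ν : ℝ) (U g : 𝕋³ → E³), 0 < ν → IsSmooth U → IsDivFree U → IsSmooth g → IsDivFree g → HasZeroMean g →
    ∃ v : ℝ → 𝕋³ → E³, IsOseenRelease ν U g v

/-- Signature of `stub_greenKubo` (provable-class, M/L: the STEADY GREEN–KUBO IDENTITY). For a classical steady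
state `U` of `NS_ν(f)` (any momentum) and the Oseen release `v` of `f` along `U`, the running Green–Kubo integral
converges to the injection: `∫₀ᵀ (f, v(τ)) dτ → (f, U)`. Proof sketch: `χ(T) := ∫₀ᵀ v` is smooth, divergence
free, mean zero and solves `(U·∇)χ − νΔχ + ∇Q = f − v(T)`; the fluctuation `Ũ = U − ∫U` solves the same steady
Oseen problem with right side `f`; the difference `e` satisfies `ν‖∇e‖² = (v(T), e)`, so by Poincaré on mean-zero
fields `‖e‖ ≤ ‖v(T)‖/(4π²ν) ≤ e^{−4π²νT}‖f‖/(4π²ν) → 0`, and `(f, χ(T)) = ∫₀ᵀ (f, v)` (Fubini), `(f, ∫U) = 0`. -/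
def Sig.stub_greenKubo : Prop :=
  ∀ (F ν : ℝ) (m n : ℕ) (U : 𝕋³ → E³) (p : 𝕋³ → ℝ) (v : ℝ → 𝕋³ → E³), 0 < ν →
    IsSteadyNSState ν (force F m n) U p → IsOseenRelease ν U (force F m n) v →
    Tendsto (gkIntegral F m n v) atTop (𝓝 (injection F m n U))

/-- Signature of `stub_kinematicHead` (provable-class, M: THE KINEMATIC HEAD). The kernel of the release of `f`
along ANY smooth divergence-free carrier of kinetic energy `≤ E₀` at viscosity `ν ≤ 1` keeps a positive running
integral over a short lag window depending only on the design and `E₀`: `C(0) = ‖f‖² = F²/4`,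
`C'(τ) = ((U·∇)f, v(τ)) + ν(Δf, v(τ))` (skew-symmetry, `div f = 0` kills the pressure), `‖v(τ)‖₂ ≤ ‖f‖₂`
(`L²`-contraction), `‖(U·∇)f‖₂ ≤ ‖∇f‖_∞ (2E₀)^{1/2}`; so `C(τ) ≥ ‖f‖² − ‖f‖Rτ` and `τ_h = ‖f‖/R`,
`h = ‖f‖³/(2R)`, `R = ‖∇f‖_∞(2E₀)^{1/2} + κ²‖f‖`. Over-mixing is excluded by bounded energy. -/
def Sig.stub_kinematicHead : Prop :=
  ∀ (F : ℝ) (m n : ℕ) (E₀ : ℝ), 0 < F → 0 < m → 0 < n → 0 < E₀ →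
    ∃ τh h : ℝ, 0 < τh ∧ 0 < h ∧
      ∀ (ν : ℝ) (U : 𝕋³ → E³) (v : ℝ → 𝕋³ → E³), 0 < ν → ν ≤ 1 → IsSmooth U → IsDivFree U →
        kineticEnergy U ≤ E₀ → IsOseenRelease ν U (force F m n) v → h ≤ gkIntegral F m n v τh

/-- Signature of `stub_noEcho` (THE CORE; conjecture-class, killable per state by ONE linear integration over a few
clock periods): NO ECHO OF FORCED-PLANE MEMORY. For the pinned design, below some `ν₁(E₀)` every `R₂`-symmetric
steady drift state with super-Doppler three-dimensionality (`½V₀² ≤` wave energy: the three-dimensional part of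
the witness sweeps the forced mode at a rate `≳ κ·u₃ᴰ ≥ κV₀ ≈ 1.1·ω`, faster than the Doppler clock `ω = 2πnV₀`
can bring the phase back) and kinetic energy `≤ E₀` has a forced-plane memory kernel whose running Green–Kubo
integral RETAINS a fixed fraction of its running maximum: `(1 − θ)·I(a) ≤ I(T)` for `0 ≤ a ≤ T`,
`θ = θ(E₀) < 1` — strictly stronger than the Green–Kubo mass bound it feeds (which for steady witnesses is
loudness itself, triage T2 (d1)), strictly weaker than the card's pointwise Markovian shape
`|σ(τ) − e^{−(γ−iδ)τ}| ≤ θe^{−γτ}` (tolerates a KAM-trapped coherent fraction, triage T2 (s2)); violated at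
`T =` one clock period by every coherent kernel `‖f‖²e^{−νκ²τ}cos ωτ` (laminar, swept, x₀-invariant, near-laminar
carriers — all outside the class). -/
def Sig.stub_noEcho : Prop :=
  ∀ E₀ : ℝ, 0 < E₀ → ∃ ν₁ θ : ℝ, 0 < ν₁ ∧ θ < 1 ∧
    ∀ (ν : ℝ) (U : 𝕋³ → E³) (p : 𝕋³ → ℝ) (v : ℝ → 𝕋³ → E³), 0 < ν → ν < ν₁ →
      IsSteadyNSState ν (force F₀ 1 2) U p → (∫ x, U x = drift V₀) → IsR2Symmetric U →
      V₀ ^ 2 / 2 ≤ waveEnergy U → kineticEnergy U ≤ E₀ → IsOseenRelease ν U (force F₀ 1 2) v →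
      ∀ a T : ℝ, 0 ≤ a → a ≤ T → (1 - θ) * gkIntegral F₀ 1 2 v a ≤ gkIntegral F₀ 1 2 v T

/-- STUB 1 (existence of super-Doppler three-dimensional bounded-energy symmetric steady drift states along
`ν_j → 0⁺`; conjecture-class). -/
theorem stub_threeDimSteadyStates : Sig.stub_threeDimSteadyStates := by
  sorry

/-- STUB 2 (the Oseen release exists; provable-class L). -/
theorem stub_oseenRelease : Sig.stub_oseenRelease := by
  sorry

/-- STUB 3 (steady Green–Kubo identity; provable-class M/L). -/
theorem stub_greenKubo : Sig.stub_greenKubo := by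
  sorry

/-- STUB 4 (kinematic head; provable-class M). -/
theorem stub_kinematicHead : Sig.stub_kinematicHead := by
  sorry

/-- STUB 5 (THE CORE: no echo of forced-plane memory; conjecture-class). -/
theorem stub_noEcho : Sig.stub_noEcho := by
  sorry

/-! ## §3 The composition (real proof) -/

/-- `|(Ψ_s, U)| ≤ ½(1 + 2E)` for a smooth field of kinetic energy `≤ E` (`‖Ψ_s‖ ≤ 1`, `∫‖U‖ ≤ ½(1 + ∫‖U‖²)`). [folklore] -/
theorem abs_quadB_le {U : 𝕋³ → E³} (hU : IsSmooth U) {E : ℝ} (hE : kineticEnergy U ≤ E) :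
    |quadB 1 2 U| ≤ 2⁻¹ * (1 + 2 * E) := by
  have hcomm : quadB 1 2 U = ∫ x, ⟪U x, psiS 1 2 x⟫_ℝ :=
    integral_congr_ae (ae_of_all _ fun x => real_inner_comm _ _)
  have h1 : |∫ x, ⟪U x, psiS 1 2 x⟫_ℝ| ≤ 1 * ∫ x, ‖U x‖ :=
    abs_integral_inner_le_of_norm_le hU.integrable
      (fun x => Summit.AnomalousDissipation.AnomalousDissipation.Theorems.EnergyFreeBridge.norm_pattern_le_one 1 2 x)
  have h2 : ∫ x, ‖U x‖ ≤ 2⁻¹ * (1 + ∫ x, ‖U x‖ ^ 2) := integral_norm_le_of_memLp_two (hU.memLp 2)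
  have h3 : ∫ x, ‖U x‖ ^ 2 = 2 * kineticEnergy U := by
    simp only [kineticEnergy]
    ring
  rw [hcomm]
  rw [h3] at h2
  have h4 : 2⁻¹ * (1 + 2 * kineticEnergy U) ≤ 2⁻¹ * (1 + 2 * E) := by linarith
  linarith

/-- COMPOSITION (real proof): three-dimensional bounded-energy symmetric steady drift states along `ν_j → 0⁺`
(stub 1) + Oseen release (stub 2) + steady Green–Kubo (stub 3) + kinematic head (stub 4) + no-echo (stub 5) ⟹
`(f, U_j) ≥ ε := (1 − θ)h` along a tail of the family ⟹ (steady energy identity, energy bound ⇒ size clause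
`ν_jκ²|(Ψ_s,U_j)| ≤ ε/2`, design ratio `2πnV/F = 1`) loud steady drift states ⟹ the crux BY NAME via
`crux_of_loudSteady`. -/
theorem QuadratureStressFloor_of (h₁ : Sig.stub_threeDimSteadyStates) (h₂ : Sig.stub_oseenRelease)
    (h₃ : Sig.stub_greenKubo) (h₄ : Sig.stub_kinematicHead) (h₅ : Sig.stub_noEcho) :
    Summit.AnomalousDissipation.AnomalousDissipation.Theses.DopplerClock.QuadratureStressFloor := by
  obtain ⟨E₀, hE₀, ν, u, p, hν, hν0, hfam⟩ := h₁
  have hF : 0 < F₀ := by unfold F₀; positivity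
  have hV : 0 < V₀ := by unfold V₀; positivity
  obtain ⟨ν₁, θ, hν₁, hθ, hret⟩ := h₅ E₀ hE₀
  obtain ⟨τh, h, hτh, hh, hhead⟩ := h₄ F₀ 1 2 E₀ hF Nat.one_pos two_pos hE₀
  -- the floor and the constants of the size clause
  set ε : ℝ := (1 - θ) * h with hεdef
  have hθ' : 0 < 1 - θ := by linarith
  have hε : 0 < ε := mul_pos hθ' hh
  set κ2 : ℝ := (2 * Real.pi) ^ 2 * (((1 : ℕ) : ℝ) ^ 2 + ((2 : ℕ) : ℝ) ^ 2) with hκ2def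
  have hκ2 : 0 < κ2 := by rw [hκ2def]; positivity
  set K₀ : ℝ := 2⁻¹ * (1 + 2 * E₀) with hK₀def
  have hK₀ : 0 < K₀ := by rw [hK₀def]; positivity
  -- the viscosity threshold and the tail of the family below it
  set νb : ℝ := min ν₁ (min 1 (ε / (2 * κ2 * K₀))) with hνbdef
  have hνb : 0 < νb := lt_min hν₁ (lt_min one_pos (by positivity))
  obtain ⟨J, hJ⟩ : ∃ J : ℕ, ∀ j ≥ J, ν j < νb :=
    eventually_atTop.1 (hν0.eventually (Iio_mem_nhds hνb))
  have hJ₁ : ∀ j, J ≤ j → ν j < ν₁ := fun j hj => (hJ j hj).trans_le (min_le_left _ _)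
  have hJ1 : ∀ j, J ≤ j → ν j ≤ 1 := fun j hj =>
    (hJ j hj).le.trans ((min_le_right _ _).trans (min_le_left _ _))
  have hJε : ∀ j, J ≤ j → ν j ≤ ε / (2 * κ2 * K₀) := fun j hj =>
    (hJ j hj).le.trans ((min_le_right _ _).trans (min_le_right _ _))
  -- the force is admissible (item 18131, landed)
  have hfa : IsSmooth (force F₀ 1 2) ∧ IsDivFree (force F₀ 1 2) ∧ HasZeroMean (force F₀ 1 2) :=
    Summit.AnomalousDissipation.AnomalousDissipation.Theorems.dopplerClock_forceAdmissible_proof F₀ 1 2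
  -- INJECTION FLOOR on the tail: release + no-echo + head + Green–Kubo
  have hinj : ∀ j, J ≤ j → ε ≤ injection F₀ 1 2 (u j) := by
    intro j hj
    obtain ⟨hst, hmom, hsym, hwave, hKE⟩ := hfam j
    have hsmU : IsSmooth (u j) := hst.smooth_velocity.isSmooth_slice (Set.mem_univ (0 : ℝ))
    have hdivU : IsDivFree (u j) := hst.divFree 0 (Set.mem_univ _)
    obtain ⟨v, hv⟩ := h₂ (ν j) (u j) (force F₀ 1 2) (hν j) hsmU hdivU hfa.1 hfa.2.1 hfa.2.2
    have hR := hret (ν j) (u j) (p j) v (hν j) (hJ₁ j hj) hst hmom hsym hwave hKE hv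
    have hH : h ≤ gkIntegral F₀ 1 2 v τh := hhead (ν j) (u j) v (hν j) (hJ1 j hj) hsmU hdivU hKE hv
    have hGK : Tendsto (gkIntegral F₀ 1 2 v) atTop (𝓝 (injection F₀ 1 2 (u j))) :=
      h₃ F₀ (ν j) 1 2 (u j) (p j) v (hν j) hst hv
    have hev : ∀ᶠ T in atTop, ε ≤ gkIntegral F₀ 1 2 v T := by
      filter_upwards [eventually_ge_atTop τh] with T hT
      have h1 : (1 - θ) * gkIntegral F₀ 1 2 v τh ≤ gkIntegral F₀ 1 2 v T := hR τh T hτh.le hT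
      have h2 : (1 - θ) * h ≤ (1 - θ) * gkIntegral F₀ 1 2 v τh := mul_le_mul_of_nonneg_left hH hθ'.le
      rw [hεdef]
      linarith
    exact ge_of_tendsto hGK hev
  -- DISSIPATION FLOOR (steady energy identity) and SIZE CLAUSE (energy bound) on the tail
  have hfloor : ∀ j, J ≤ j → ε ≤ ν j * gradNormSq (u j) := fun j hj => by
    rw [steady_energy_identity (hfam j).1]
    exact hinj j hj
  have hB : ∀ j, J ≤ j → ν j * κ2 * |quadB 1 2 (u j)| ≤ ε / 2 := by
    intro j hj
    obtain ⟨hst, -, -, -, hKE⟩ := hfam j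
    have hsmU : IsSmooth (u j) := hst.smooth_velocity.isSmooth_slice (Set.mem_univ (0 : ℝ))
    have hq : |quadB 1 2 (u j)| ≤ K₀ := abs_quadB_le hsmU hKE
    calc ν j * κ2 * |quadB 1 2 (u j)| ≤ ν j * κ2 * K₀ :=
          mul_le_mul_of_nonneg_left hq (mul_nonneg (hν j).le hκ2.le)
      _ ≤ ε / (2 * κ2 * K₀) * κ2 * K₀ := by gcongr; exact hJε j hj
      _ = ε / 2 := by field_simp
  -- loud steady drift states along the tail `j ↦ j + J`, hence the crux by name
  have hδ : ε / 2 < V₀ * (2 * Real.pi * (2 : ℕ)) / F₀ * ε := by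
    rw [design_ratio]; linarith
  have hloud : SteadyLoudDriftStates :=
    ⟨F₀, V₀, 1, 2, hF, hV, Nat.one_pos, two_pos, fun j => ν (j + J), fun j => u (j + J), fun j => p (j + J),
      fun j => hν _, hν0.comp (tendsto_add_atTop_nat J), fun j => (hfam _).1, fun j => (hfam _).2.1,
      ε, ε / 2, hε, hδ, fun j => hfloor _ (Nat.le_add_left J j),
      fun j => by simpa [hκ2def] using hB (j + J) (Nat.le_add_left J j)⟩
  exact crux_of_loudSteady hloud

/-- The crux modulo the five registered stubs. -/
theorem QuadratureStressFloor_proof :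
    Summit.AnomalousDissipation.AnomalousDissipation.Theses.DopplerClock.QuadratureStressFloor :=
  QuadratureStressFloor_of stub_threeDimSteadyStates stub_oseenRelease stub_greenKubo stub_kinematicHead
    stub_noEcho

end Summit.AnomalousDissipation.AnomalousDissipation.Cruxes.QuadratureStressFloor.OseenMemoryDopplerLine

end
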